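import Summits.Ventures.HSemireg.Pad4TowerDeltaWindow

/-!
# Venture HSemireg — PAD-4 on 𝔅(μ₄): the FACTOR-PERMUTATION (S₄) class algebra and the `G₁ = ⟨Δ⟩ × S₄` averaging WLOG —
# `ch(σ·Z)(w) = ch(Z)(σ⁻¹·w)` (a permuted class permutes the WORD, it does NOT act by a scalar), the class screen (A1) and the
# μ-word are S₄-stable, S₄-averaging and `G₁`-averaging preserve «(A1), m ≥ 1, μ ≠ 0», and an S₄-invariant design has an
# S₄-invariant class tensor (one row per S₄-orbit of words)

HONEST FRAMING. Lean index of the computation cell `pub-hsemireg` (S4-PUSH, H2 door PAD-4), typed by the Ventures-side typer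
`hodge-lit-semireg-typer-2` (g4; line of record stmt-HodgeConjecture-18881 `Cruxes/BlochSeedDiscOne/Lines/birth.lean` 814a6a70c14e831a,
stub `stub_rung_pad4_seedAt`, screen (H1) = the class condition (A1)). Seventh file of the KERNEL LEMMA Ψ ⊂ (A1) set; companion of
`Pad4TowerDeltaWindow` (the Δ-window algebra) for the AUTHORISED `Δ × S₄` LEG (director-hodge g12, cell INBOX l.31981: «the chiral Δ×S₄
sub-cell (Δ-closed AND closed under the 24 factor permutations, no sign flips)»; bc5-plan g6 IDEATOR LINE 3 (1) SPEC l.31989: «by averaging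
over the finite group G₁ (rows, ℚ[h] ⊕ W and μ = coeff(eeee) are G₁-stable — `deltaInvariant_wlog`'s proof is group-agnostic) "G₁-closed
support" ⇔ "G₁-invariant design", so the class variable := the G₁-ORBIT»; gs-eng-2 g51 PRE-EMPTIVE ENGINE NOTE l.31990 (1): «A factor
permutation σ does NOT act by a scalar: T_{σZ}[w] = T_Z[σ⁻¹·w] (it permutes the WORD's slots) … "|orbit| × T_rep[w]" would be WRONG …
since a G₁-invariant design has D[w] = D[σw], keep ONE row per S₄-orbit of words»). THIS FILE TYPES EXACTLY THOSE SENTENCES as kernel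
theorems in the frame of record (`Pad4TowerClassScreen` ∕ `Pad4TowerPsiSubA1` ∕ `Pad4TowerDeltaWindow`).

CONTENT (all PROVED; no `sorry`; axioms standard).
* §1 `permW σ w` (`(σ·w)_f = w_{σ f}`), `permW_one ∕ _mul ∕ _inv_permW ∕ _permW_inv`, `wdeg_permW` (degree is S₄-invariant),
  `eFree_permW_iff`, `permW_eWord ∕ permW_ebarWord` (the μ-words are FIXED), **`classScreen_permW`: (A1) is S₄-stable**, `classScreen_zero`.
* §2 `MCell.perm σ Z` (`(σ·Z)_f = Z_{σ f}`), `perm_one ∕ _mul ∕ _perm_inv ∕ _inv_perm ∕ _injective`, `chTensor_eq_prod`,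
  **`MCell.ch_perm`: `ch(σ·Z)(w) = ch(Z)(σ⁻¹·w)`** (gs-eng-2 g51 (1), kernel) and the probe `perm_probe` (a permuted cell's tensor is NOT
  a scalar multiple of the cell's: two coefficients move differently).
* §3 `PermClosed` supports, `permClosed_of_swapClosed` (closed under the six transpositions ⇒ S₄-closed), `image_perm_eq`, `sum_perm_reindex`, **`MConfig.wch_comp_perm`** (weights transported by σ ⇒ class tensor
  composed with `permW σ`), **`MConfig.wch_permW_of_permInvariant`** (S₄-invariant weights ⇒ `wch(σ·w) = wch(w)`: one row per
  S₄-orbit of words).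
* §4 `permAvg m Z = Σ_σ m(σ·Z)` (the S₄-average, ×24), `permAvg_perm` (invariant), `permAvg_pos`, `MConfig.wch_permAvg`
  (`= Σ_σ wch ∘ permW σ`), **`MConfig.classScreen_permAvg`** ((A1) survives), **`MConfig.wch_permAvg_eWord`** (`μ ↦ 24μ`),
  **`MConfig.permInvariant_wlog`**.
* §5 `G₁ = ⟨Δ⟩ × S₄`: `MCell.delta_perm` (Δ and σ commute), `deltaAvg_permInvariant`, `g1Avg = deltaAvg ∘ permAvg` (×96),
  **`MConfig.g1Invariant_wlog`**: on a support that is Δ-closed and S₄-closed, weights `m ≥ 1` with (A1) and `μ ≠ 0` yield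
  G₁-INVARIANT weights `g1Avg m ≥ 1` with (A1) and `μ ≠ 0` — «G₁-closed support carries an (A1)∕μ≠0 solution iff it carries a
  G₁-invariant one»; `MConfig.wch_g1Avg_eWord` (`μ ↦ 96μ`).
* §6 `psiTwelve_permW` (12Ψ is a symmetric function of the four factors: invariance under every factor permutation, by swap induction),
  `MCell.psi12_perm`, `MCell.psiQ_perm` (Ψ of a permuted cell = Ψ of the cell — spec (4)(e): the Ψ presence clause aggregates per orbit
  unchanged).

WHAT IS NOT HERE ∕ NOT IN LEAN. Orbit counts (Burnside numbers of the spec), canonical forms, the encoder, any SAT verdict, sign flips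
(this is the CHIRAL group: no `β ↦ β̄`), the S₄-invariance of the Λ_k values of `Pad4TowerEFreeAnnihilators` (same method; not needed for
the WLOG). The identification of the frame with `H^{ev}(S⁴)` stays the cell's pencil modelling sentence. No variety, sheaf, σ-operator, seed
or abelian variety; NOTHING HERE SAYS THAT HC ∕ HC_CM ∕ HC_AV ∕ W₆ ∕ HC_Kum4Type HOLDS OR FAILS. No `instance`, no notation, no named
fact, 0 `sorry`.

SOURCES (sha16 ∕ bus): `Pad4TowerDeltaWindow.lean` (this seat, v3 85a2925c82a6c0e4), `Pad4TowerPsiSubA1.lean` (p595255),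
`Pad4TowerClassScreen.lean` (p591160); cell INBOX l.31981 (director-hodge g12), l.31989 (bc5-plan g6), l.31990 (gs-eng-2 g51).
-/

namespace Summit.Ventures.HSemireg.Pad4Tower

open Finset

/-! ## §1 Factor permutations on words; the class screen is S₄-stable -/

/-- a factor permutation acting on a word: `(σ·w)_f = w_{σ f}`. -/
def permW (σ : Equiv.Perm (Fin 4)) (w : CWord) : CWord := fun f => w (σ f)

/-- unfolding `permW`. -/
theorem permW_apply (σ : Equiv.Perm (Fin 4)) (w : CWord) (f : Fin 4) : permW σ w f = w (σ f) := rfl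

/-- the identity permutation fixes every word. -/
theorem permW_one (w : CWord) : permW 1 w = w := rfl

/-- `permW` is a right action: `(σ τ)·w = τ·(σ·w)`. -/
theorem permW_mul (σ τ : Equiv.Perm (Fin 4)) (w : CWord) : permW (σ * τ) w = permW τ (permW σ w) := rfl

/-- `σ⁻¹` undoes `σ` on words. -/
theorem permW_inv_permW (σ : Equiv.Perm (Fin 4)) (w : CWord) : permW σ⁻¹ (permW σ w) = w := by
  rw [← permW_mul, mul_inv_cancel, permW_one]

/-- `σ` undoes `σ⁻¹` on words. -/
theorem permW_permW_inv (σ : Equiv.Perm (Fin 4)) (w : CWord) : permW σ (permW σ⁻¹ w) = w := by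
  rw [← permW_mul, inv_mul_cancel, permW_one]

/-- the degree of a word as a `Fin 4`-sum. -/
theorem wdeg_eq_sum (w : CWord) : wdeg w = ∑ f, ldeg (w f) := by
  simp [wdeg, Fin.sum_univ_four]

/-- the degree of a word is S₄-invariant. -/
theorem wdeg_permW (σ : Equiv.Perm (Fin 4)) (w : CWord) : wdeg (permW σ w) = wdeg w := by
  rw [wdeg_eq_sum, wdeg_eq_sum]
  exact Equiv.sum_comp σ (fun f => ldeg (w f))

/-- e-freeness is S₄-invariant. -/
theorem eFree_permW_iff (σ : Equiv.Perm (Fin 4)) (w : CWord) : EFree (permW σ w) ↔ EFree w :=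
  ⟨fun h f => by simpa [permW] using h (σ.symm f), fun h f => h (σ f)⟩

/-- the μ-word `eeee` is FIXED by every factor permutation. -/
theorem permW_eWord (σ : Equiv.Perm (Fin 4)) : permW σ eWord = eWord := by
  have h : ∀ g : Fin 4, eWord g = 3 := by decide
  funext f
  rw [permW_apply, h, h]

/-- `ēēēē` is FIXED by every factor permutation. -/
theorem permW_ebarWord (σ : Equiv.Perm (Fin 4)) : permW σ ebarWord = ebarWord := by
  have h : ∀ g : Fin 4, ebarWord g = 4 := by decide
  funext f
  rw [permW_apply, h, h]

/-- **THE CLASS SCREEN (A1) IS S₄-STABLE**: if `T` passes the screen, so does `T ∘ (σ·)` — both clauses of the screen speak of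
e-mixedness, the two μ-words and the degree, all S₄-invariant. -/
theorem classScreen_permW {R : Type*} [Zero R] (σ : Equiv.Perm (Fin 4)) {T : CWord → R} (h : ClassScreen T) :
    ClassScreen (fun w => T (permW σ w)) := by
  refine ⟨fun w hw h1 h2 => h.1 _ (mt (eFree_permW_iff σ w).1 hw) ?_ ?_, fun w w' hw hw' hd =>
    h.2 _ _ ((eFree_permW_iff σ w).2 hw) ((eFree_permW_iff σ w').2 hw') (by rw [wdeg_permW, wdeg_permW, hd])⟩
  · intro e
    apply h1
    rw [← permW_inv_permW σ w, e, permW_eWord]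
  · intro e
    apply h2
    rw [← permW_inv_permW σ w, e, permW_ebarWord]

/-- the zero class function passes the screen. -/
theorem classScreen_zero {R : Type*} [Zero R] : ClassScreen (0 : CWord → R) :=
  ⟨fun _ _ _ _ => rfl, fun _ _ _ _ _ => rfl⟩

/-! ## §2 Factor permutations on cells: `ch(σ·Z)(w) = ch(Z)(σ⁻¹·w)` -/

/-- a factor permutation acting on a 𝔅(μ₄) cell: `(σ·Z)_f = Z_{σ f}`. -/
def MCell.perm (σ : Equiv.Perm (Fin 4)) (Z : MCell) : MCell := fun f => Z (σ f)

/-- unfolding `MCell.perm`. -/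
theorem MCell.perm_apply (σ : Equiv.Perm (Fin 4)) (Z : MCell) (f : Fin 4) : Z.perm σ f = Z (σ f) := rfl

/-- the identity permutation fixes every cell. -/
theorem MCell.perm_one (Z : MCell) : Z.perm 1 = Z := rfl

/-- `MCell.perm` is a right action: `(σ τ)·Z = τ·(σ·Z)`. -/
theorem MCell.perm_mul (σ τ : Equiv.Perm (Fin 4)) (Z : MCell) : Z.perm (σ * τ) = (Z.perm σ).perm τ := rfl

/-- `σ⁻¹` undoes `σ` on cells. -/
theorem MCell.perm_perm_inv (σ : Equiv.Perm (Fin 4)) (Z : MCell) : (Z.perm σ).perm σ⁻¹ = Z := by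
  rw [← MCell.perm_mul, mul_inv_cancel, MCell.perm_one]

/-- `σ` undoes `σ⁻¹` on cells. -/
theorem MCell.perm_inv_perm (σ : Equiv.Perm (Fin 4)) (Z : MCell) : (Z.perm σ⁻¹).perm σ = Z := by
  rw [← MCell.perm_mul, inv_mul_cancel, MCell.perm_one]

/-- each factor permutation acts injectively on cells. -/
theorem MCell.perm_injective (σ : Equiv.Perm (Fin 4)) : Function.Injective (MCell.perm σ) := fun Z Z' h => by
  simpa [MCell.perm_perm_inv] using congrArg (MCell.perm σ⁻¹) h

/-- the class tensor of a product letter vector as a `Fin 4`-product. -/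
theorem chTensor_eq_prod {R : Type*} [CommRing R] (v : Fin 4 → Fin 6 → R) (w : CWord) :
    chTensor v w = ∏ f, v f (w f) := by
  simp [chTensor, Fin.prod_univ_four]

/-- **THE CLASS TENSOR OF A PERMUTED CELL IS THE CELL'S TENSOR ON THE INVERSELY PERMUTED WORD** (gs-eng-2 g51 l.31990 (1):
«T_{σZ}[w] = T_Z[σ⁻¹·w] — it permutes the WORD's slots», here with `(σ·Z)_f = Z_{σ f}`, `(σ·w)_f = w_{σ f}`):
`ch(σ·Z)(w) = ch(Z)(σ⁻¹·w)`. -/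
theorem MCell.ch_perm (σ : Equiv.Perm (Fin 4)) (Z : MCell) (w : CWord) : (Z.perm σ).ch w = Z.ch (permW σ⁻¹ w) := by
  simp only [MCell.ch, chTensor_eq_prod, MCell.perm_apply, permW_apply]
  rw [← Equiv.prod_comp σ (fun g => bphi (Z g) (w (σ⁻¹ g)))]
  exact Finset.prod_congr rfl fun f _ => by rw [show σ⁻¹ (σ f) = f from σ.symm_apply_apply f]

/-! ## §3 S₄-closed supports; transporting the weights permutes the words -/

/-- a finite set of cells is S₄-CLOSED (closed under all 24 factor permutations). -/
abbrev PermClosed (S : Finset MCell) : Prop := ∀ σ : Equiv.Perm (Fin 4), ∀ Z ∈ S, Z.perm σ ∈ S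

/-- a support closed under the six TRANSPOSITIONS is S₄-closed (swap induction) — the finite check an encoder performs. -/
theorem permClosed_of_swapClosed {S : Finset MCell} (h : ∀ x y : Fin 4, x ≠ y → ∀ Z ∈ S, Z.perm (Equiv.swap x y) ∈ S) :
    PermClosed S := by
  intro σ
  induction σ using Equiv.Perm.swap_induction_on with
  | one => intro Z hZ; simpa [MCell.perm_one] using hZ
  | swap_mul τ x y hxy ih =>
    intro Z hZ
    rw [MCell.perm_mul]
    exact ih _ (h x y hxy Z hZ)

/-- on an S₄-closed finite set each `σ` is a permutation: its image is the whole set. -/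
theorem image_perm_eq (S : Finset MCell) (hS : PermClosed S) (σ : Equiv.Perm (Fin 4)) : S.image (MCell.perm σ) = S := by
  apply Finset.eq_of_subset_of_card_le
  · intro x hx
    obtain ⟨Z, hZ, rfl⟩ := Finset.mem_image.1 hx
    exact hS σ Z hZ
  · rw [Finset.card_image_of_injective _ (MCell.perm_injective σ)]

/-- REINDEXING by `σ` on an S₄-closed set: `Σ_{Z ∈ S} g(σ·Z) = Σ_{Z ∈ S} g(Z)`. -/
theorem sum_perm_reindex {M : Type*} [AddCommMonoid M] (S : Finset MCell) (hS : PermClosed S) (σ : Equiv.Perm (Fin 4))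
    (g : MCell → M) : ∑ Z ∈ S, g (Z.perm σ) = ∑ Z ∈ S, g Z := by
  conv_rhs => rw [← image_perm_eq S hS σ]
  rw [Finset.sum_image fun Z _ Z' _ h => MCell.perm_injective σ h]

/-- **TRANSPORTING THE WEIGHTS BY `σ` PERMUTES THE WORDS**: on an S₄-closed support,
`Σ m(σ·Z)·ch(Z)(w) − … = (Σ m(Z)·ch(Z) − …)(σ·w)` (substitute `Z = σ⁻¹·x` and use `ch_perm`). -/
theorem MConfig.wch_comp_perm (C : MConfig) (hl : PermClosed C.lower) (hu : PermClosed C.upper) (mN mP : MCell → ℤ)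
    (σ : Equiv.Perm (Fin 4)) (w : CWord) :
    C.wch (fun Z => mN (Z.perm σ)) (fun P => mP (P.perm σ)) w = C.wch mN mP (permW σ w) := by
  have key : ∀ (S : Finset MCell), PermClosed S → ∀ m : MCell → ℤ,
      (∑ Z ∈ S, m (Z.perm σ) • Z.ch) w = (∑ Z ∈ S, m Z • Z.ch) (permW σ w) := by
    intro S hS m
    have r := sum_perm_reindex S hS σ⁻¹ (fun Z => m (Z.perm σ) • Z.ch)
    simp only [MCell.perm_inv_perm] at r
    rw [← r]
    simp only [Finset.sum_apply, Pi.smul_apply, MCell.ch_perm, inv_inv]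
  simp only [MConfig.wch, Pi.sub_apply, key C.lower hl mN, key C.upper hu mP]

/-- **AN S₄-INVARIANT DESIGN HAS AN S₄-INVARIANT CLASS TENSOR** (gs-eng-2 g51 l.31990 (1): «a G₁-invariant design has
`D[w] = D[σw]` — keep ONE row per S₄-orbit of words»): `wch(σ·w) = wch(w)` for every word and every `σ`. -/
theorem MConfig.wch_permW_of_permInvariant (C : MConfig) (hl : PermClosed C.lower) (hu : PermClosed C.upper)
    (mN mP : MCell → ℤ) (hN : ∀ σ Z, mN (MCell.perm σ Z) = mN Z) (hP : ∀ σ P, mP (MCell.perm σ P) = mP P)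
    (σ : Equiv.Perm (Fin 4)) (w : CWord) : C.wch mN mP (permW σ w) = C.wch mN mP w := by
  have h := C.wch_comp_perm hl hu mN mP σ w
  simp only [hN, hP] at h
  exact h.symm

/-! ## §4 S₄-averaging is WLOG -/

/-- the S₄-AVERAGE (×24) of a weight function: `Σ_σ m(σ·Z)`. -/
def permAvg (m : MCell → ℤ) (Z : MCell) : ℤ := ∑ σ : Equiv.Perm (Fin 4), m (Z.perm σ)

/-- the S₄-average is S₄-invariant. -/
theorem permAvg_perm (m : MCell → ℤ) (τ : Equiv.Perm (Fin 4)) (Z : MCell) : permAvg m (Z.perm τ) = permAvg m Z := by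
  unfold permAvg
  simp only [← MCell.perm_mul]
  exact Fintype.sum_equiv (Equiv.mulLeft τ) _ _ fun σ => rfl

/-- the S₄-average of positive weights on an S₄-closed support is positive there. -/
theorem permAvg_pos {S : Finset MCell} (hS : PermClosed S) {m : MCell → ℤ} (hm : ∀ Z ∈ S, 0 < m Z) (Z : MCell) (hZ : Z ∈ S) :
    0 < permAvg m Z :=
  Finset.sum_pos (fun σ _ => hm _ (hS σ Z hZ)) Finset.univ_nonempty

/-- the weighted tensor of the S₄-averaged design is the sum over `σ` of the word-permuted tensors. -/
theorem MConfig.wch_permAvg (C : MConfig) (hl : PermClosed C.lower) (hu : PermClosed C.upper) (mN mP : MCell → ℤ)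
    (w : CWord) : C.wch (permAvg mN) (permAvg mP) w = ∑ σ : Equiv.Perm (Fin 4), C.wch mN mP (permW σ w) := by
  have add : C.wch (permAvg mN) (permAvg mP) =
      ∑ σ : Equiv.Perm (Fin 4), C.wch (fun Z => mN (Z.perm σ)) (fun P => mP (P.perm σ)) := by
    simp only [MConfig.wch, permAvg, Finset.sum_smul, Finset.sum_sub_distrib]
    congr 1 <;> exact Finset.sum_comm
  rw [add, Finset.sum_apply]
  exact Finset.sum_congr rfl fun σ _ => C.wch_comp_perm hl hu mN mP σ w

/-- **S₄-AVERAGING PRESERVES (A1)** (stated over `GaussianInt`, where the weighted class tensor and `Pad4TowerDeltaWindow.classScreen_add`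
live; `classScreen_permW` itself is generic — s4-ref g85 (G) P1). -/
theorem MConfig.classScreen_permAvg (C : MConfig) (hl : PermClosed C.lower) (hu : PermClosed C.upper) (mN mP : MCell → ℤ)
    (h : ClassScreen (C.wch mN mP)) : ClassScreen (C.wch (permAvg mN) (permAvg mP)) := by
  have e : C.wch (permAvg mN) (permAvg mP) = ∑ σ : Equiv.Perm (Fin 4), fun w => C.wch mN mP (permW σ w) := by
    funext w
    rw [C.wch_permAvg hl hu, Finset.sum_apply]
  rw [e]
  exact Finset.sum_induction _ ClassScreen (fun a b ha hb => classScreen_add ha hb) classScreen_zero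
    fun σ _ => classScreen_permW σ h

/-- **S₄-AVERAGING MULTIPLIES THE μ-WORD BY 24** (`σ·eeee = eeee`) — so `μ ≠ 0` is preserved. -/
theorem MConfig.wch_permAvg_eWord (C : MConfig) (hl : PermClosed C.lower) (hu : PermClosed C.upper) (mN mP : MCell → ℤ) :
    C.wch (permAvg mN) (permAvg mP) eWord = 24 * C.wch mN mP eWord := by
  rw [C.wch_permAvg hl hu]
  simp only [permW_eWord, Finset.sum_const, Finset.card_univ, Fintype.card_perm, Fintype.card_fin, nsmul_eq_mul]
  norm_num [Nat.factorial]

/-- **S₄-AVERAGING IS WLOG** (kernel form of spec (1) for the factor permutations): on an S₄-closed support, weights `m ≥ 1` satisfying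
(A1) with `μ ≠ 0` yield the S₄-INVARIANT weights `permAvg m ≥ 1` satisfying (A1) with `μ ≠ 0`. -/
theorem MConfig.permInvariant_wlog (C : MConfig) (hl : PermClosed C.lower) (hu : PermClosed C.upper) (mN mP : MCell → ℤ)
    (hN : ∀ Z ∈ C.lower, 0 < mN Z) (hP : ∀ P ∈ C.upper, 0 < mP P) (h : ClassScreen (C.wch mN mP))
    (hμ : C.wch mN mP eWord ≠ 0) :
    (∀ σ Z, permAvg mN (MCell.perm σ Z) = permAvg mN Z) ∧ (∀ σ P, permAvg mP (MCell.perm σ P) = permAvg mP P) ∧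
      (∀ Z ∈ C.lower, 0 < permAvg mN Z) ∧ (∀ P ∈ C.upper, 0 < permAvg mP P) ∧
      ClassScreen (C.wch (permAvg mN) (permAvg mP)) ∧ C.wch (permAvg mN) (permAvg mP) eWord ≠ 0 := by
  refine ⟨fun σ Z => permAvg_perm mN σ Z, fun σ P => permAvg_perm mP σ P, permAvg_pos hl hN, permAvg_pos hu hP,
    C.classScreen_permAvg hl hu mN mP h, ?_⟩
  rw [C.wch_permAvg_eWord hl hu]
  exact mul_ne_zero (by norm_num) hμ

/-! ## §5 `G₁ = ⟨Δ⟩ × S₄`: Δ and the factor permutations commute; the joint average is WLOG -/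

/-- Δ (the same phase rotation on every factor) COMMUTES with every factor permutation. -/
theorem MCell.delta_perm (σ : Equiv.Perm (Fin 4)) (Z : MCell) : (Z.perm σ).delta = Z.delta.perm σ := rfl

/-- the Δ-average of an S₄-invariant weight is S₄-invariant. -/
theorem deltaAvg_permInvariant (m : MCell → ℤ) (hm : ∀ σ Z, m (MCell.perm σ Z) = m Z) (σ : Equiv.Perm (Fin 4)) (Z : MCell) :
    deltaAvg m (Z.perm σ) = deltaAvg m Z := by
  simp only [deltaAvg, MCell.delta_perm, hm]

/-- the `G₁`-AVERAGE (×96): Δ-average of the S₄-average. -/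
def g1Avg (m : MCell → ℤ) : MCell → ℤ := deltaAvg (permAvg m)

/-- the `G₁`-average multiplies the μ-word by `96 = |G₁|`. -/
theorem MConfig.wch_g1Avg_eWord (C : MConfig) (hlΔ : DeltaClosed C.lower) (huΔ : DeltaClosed C.upper) (hl : PermClosed C.lower)
    (hu : PermClosed C.upper) (mN mP : MCell → ℤ) : C.wch (g1Avg mN) (g1Avg mP) eWord = 96 * C.wch mN mP eWord := by
  rw [g1Avg, g1Avg, C.wch_deltaAvg_eWord hlΔ huΔ, C.wch_permAvg_eWord hl hu]
  ring

/-- **`G₁`-AVERAGING IS WLOG** (bc5-plan g6 IDEATOR LINE 3 (1), kernel form: «"G₁-closed support" ⇔ "G₁-invariant design", so the class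
variable := the G₁-ORBIT»): on a support closed under Δ AND under the 24 factor permutations, weights `m ≥ 1` satisfying (A1) with `μ ≠ 0`
yield weights `g1Avg m ≥ 1` that are Δ-INVARIANT and S₄-INVARIANT, satisfy (A1), and have `μ ≠ 0`. -/
theorem MConfig.g1Invariant_wlog (C : MConfig) (hlΔ : DeltaClosed C.lower) (huΔ : DeltaClosed C.upper) (hl : PermClosed C.lower)
    (hu : PermClosed C.upper) (mN mP : MCell → ℤ) (hN : ∀ Z ∈ C.lower, 0 < mN Z) (hP : ∀ P ∈ C.upper, 0 < mP P)
    (h : ClassScreen (C.wch mN mP)) (hμ : C.wch mN mP eWord ≠ 0) :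
    (∀ Z, g1Avg mN Z.delta = g1Avg mN Z) ∧ (∀ σ Z, g1Avg mN (MCell.perm σ Z) = g1Avg mN Z) ∧
      (∀ P, g1Avg mP P.delta = g1Avg mP P) ∧ (∀ σ P, g1Avg mP (MCell.perm σ P) = g1Avg mP P) ∧
      (∀ Z ∈ C.lower, 0 < g1Avg mN Z) ∧ (∀ P ∈ C.upper, 0 < g1Avg mP P) ∧
      ClassScreen (C.wch (g1Avg mN) (g1Avg mP)) ∧ C.wch (g1Avg mN) (g1Avg mP) eWord ≠ 0 := by
  obtain ⟨iN, iP, pN, pP, hA1, hμ'⟩ := C.permInvariant_wlog hl hu mN mP hN hP h hμ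
  obtain ⟨dN, dP, qN, qP, hA1', hμ''⟩ := C.deltaInvariant_wlog hlΔ huΔ (permAvg mN) (permAvg mP) pN pP hA1 hμ'
  exact ⟨dN, fun σ Z => deltaAvg_permInvariant _ iN σ Z, dP, fun σ P => deltaAvg_permInvariant _ iP σ P, qN, qP, hA1', hμ''⟩

/-! ## §6 Ψ of a cell is S₄-invariant -/

/-- `12Ψ` is invariant under a transposition of two factors (the three pairings are permuted). -/
theorem psiTwelve_swap {R : Type*} [CommRing R] (α s : Fin 4 → R) (x y : Fin 4) :
    psiTwelve (fun f => α (Equiv.swap x y f)) (fun f => s (Equiv.swap x y f)) = psiTwelve α s := by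
  fin_cases x <;> fin_cases y <;>
    simp [psiTwelve, Equiv.swap_apply_of_ne_of_ne, Equiv.swap_apply_left, Equiv.swap_apply_right] <;> ring

/-- **`12Ψ` IS A SYMMETRIC FUNCTION OF THE FOUR FACTORS**: invariant under every factor permutation (swap induction). -/
theorem psiTwelve_permW {R : Type*} [CommRing R] (σ : Equiv.Perm (Fin 4)) (α s : Fin 4 → R) :
    psiTwelve (fun f => α (σ f)) (fun f => s (σ f)) = psiTwelve α s := by
  induction σ using Equiv.Perm.swap_induction_on generalizing α s with
  | one => rfl
  | swap_mul τ x y _ ih =>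
    have h := ih (fun g => α (Equiv.swap x y g)) (fun g => s (Equiv.swap x y g))
    exact h.trans (psiTwelve_swap α s x y)

/-- `12Ψ(σ·Z) = 12Ψ(Z)`. -/
theorem MCell.psi12_perm (σ : Equiv.Perm (Fin 4)) (Z : MCell) : (Z.perm σ).psi12 = Z.psi12 := by
  simp only [MCell.psi12, MCell.perm_apply]
  exact psiTwelve_permW σ (fun f => (Z f).1) (fun f => (Z f).2.1 ^ 2 + (Z f).2.2 ^ 2)

/-- **Ψ OF A PERMUTED CELL IS Ψ OF THE CELL** (spec (4)(e): the two-sided Ψ presence clause aggregates per `G₁`-orbit unchanged;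
together with `Pad4TowerPsiSubA1`'s Δ-blindness of Ψ — it reads only `α` and `|β|²`). -/
theorem MCell.psiQ_perm (σ : Equiv.Perm (Fin 4)) (Z : MCell) : (Z.perm σ).psiQ = Z.psiQ := by
  have h := congrArg (fun n : ℤ => (n : ℚ)) (MCell.psi12_perm σ Z)
  simp only [MCell.psi12_cast] at h
  linarith

/-! ## §7 Kernel probes -/

/-- a cell with two different factors and the transposition `(0 1)`: the permuted cell is a different cell, its class tensor takes the
value of the original on the transposed word (`ch_perm`), and it is NOT a scalar multiple of the original tensor — the coefficient of
`[α 1 1 1]` moves from `α₀ = 1` to `α₁ = 2` while `[1 1 1 1] = 1` stays (so no scalar works). [kernel, `decide`] -/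
theorem perm_probe :
    (mcellOf (lpt 1 0) (2, 0, 0) (0, 0, 0) (lpt 1 1)).perm (Equiv.swap 0 1) ≠ mcellOf (lpt 1 0) (2, 0, 0) (0, 0, 0) (lpt 1 1) ∧
    (mcellOf (lpt 1 0) (2, 0, 0) (0, 0, 0) (lpt 1 1)).ch ![1, 0, 0, 0] = 1 ∧
    ((mcellOf (lpt 1 0) (2, 0, 0) (0, 0, 0) (lpt 1 1)).perm (Equiv.swap 0 1)).ch ![1, 0, 0, 0] = 2 ∧
    (mcellOf (lpt 1 0) (2, 0, 0) (0, 0, 0) (lpt 1 1)).ch ![0, 0, 0, 0] = 1 ∧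
    ((mcellOf (lpt 1 0) (2, 0, 0) (0, 0, 0) (lpt 1 1)).perm (Equiv.swap 0 1)).ch ![0, 0, 0, 0] = 1 := by
  decide +kernel

end Summit.Ventures.HSemireg.Pad4Tower
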